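import Summits.QuantumFields.YangMills.Theorems.IR.Negative.TypOnsetFloorPoly.Ref

/-!
# Crux `IR` (stmt-QuantumFields-19354) — the POLYNOMIAL ROW FLOOR `b⋆_T(β) ≥ c·(β / log β)^{1/7}` for EVERY compact gauge group,
# part 9/10: §4l the reference filling typed (`refFill`, `refConfig`) and R1 ⇐ R1d, §4m toward R1d: the filling IS the twisted configuration (sections `Weighted`, `TwistEnergy`)

Re-homed VERBATIM (statements, proofs, names; namespace `…Cruxes.IR.CruxIdea2g7` ↦ `…Cruxes.IR.RowFloorPoly`) from the crux
workfile `Cruxes/IR/CruxIdea2RowFloorPoly.lean` rev 14 (sha16 742d7312ea0b5c70; author `ym-cruxidea-19354-2` GEN 7; kernel certificate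
`Cruxes/IR/CruxIdea2RowFloorPolyCert.lean` rev 1, sha16 59d3cfe64fab9c7c, gate-elaborated stub-free) per owner R114 (2) (landing seat:
the `ym-19354-disprove-1` lineage, g9), split by its sections into ten ≤ 400-line modules chained by import; the module docstring of
record (history, theorem map, honest framing) is in the headline module `Theorems/IR/Negative/TypOnsetFloorPoly.lean` (part 10/10).
Negative knowledge for stmt-QuantumFields-19354 (`--supports`; closes no stub); not mixing, not a mass gap, nothing about Clay.
-/

set_option autoImplicit false

noncomputable section

open MeasureTheory Filter Topology
open Literature.MathematicalPhysics.QuantumLattice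
open Literature.Probability.LatticeModels
open Summit.QuantumFields.YangMills.Cruxes.IR.Tempered (cellEdges windowCells regionEdges)
open Summit.QuantumFields.YangMills.Cruxes.IR.ShellTempered (windowCellsPlus)
open Summit.QuantumFields.YangMills.Cruxes.IR.OnsetFormats (TypShellCond shellCount)
open Summit.QuantumFields.YangMills.Cruxes.IR.FixedMesh
open Summit.QuantumFields.YangMills.Cruxes.IR.FixedMeshAllG
open Summit.QuantumFields.YangMills.Theorems.FemtoCurvatureTwoPoint.DoublingOfRV (norm_rho_mul_sub_one_le norm_rho_inv_sub_one)
open Summit.QuantumFields.YangMills.Cruxes.IR.HairpinStokes (norm_map_conj_sub_one sub_re_trace_eq_norm_sq)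
open Literature.MathematicalPhysics.QuantumFieldTheory (abs_re_trace_le_sqrt_mul re_trace_map_inv)
open Summit.QuantumFields.YangMills.Theorems.FemtoCurvatureTwoPointC.TorusGauge.TwistLower (norm_rho_mul_sub_rho_mul_le norm_rho_inv_sub_rho_inv)

namespace Summit.QuantumFields.YangMills.Cruxes.IR.RowFloorPoly

/-! ## §4l (PROVED; rev 11) The reference filling typed (`refFill`, `refConfig`), its continuity, and R1 ⇐ R1d:
integrating a DETERMINISTIC weighted domination against the torus Wilson measure (`AfOnset.exists_plaquetteCost_moments_le`) -/

section Weighted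

open scoped Matrix Matrix.Norms.Frobenius
open Literature.MathematicalPhysics.QuantumFieldTheory (wilsonMeasure GaugeConfig isProbabilityMeasure_wilsonMeasure
  LatticeRep plaquetteCost Plaquette)
open Summit.QuantumFields.YangMills.Theorems.TunedSequenceExists.Negative.Freezing (plaquetteHolonomyZd_torusLift'
  integrable_of_continuous)

variable {G : Type} [Group G] [TopologicalSpace G] [IsTopologicalGroup G] [CompactSpace G]
  [SecondCountableTopology G] [MeasurableSpace G] [BorelSpace G]
  {N : ℕ} (ρ : G →* Matrix (Fin N) (Fin N) ℂ)

/-- **The REFERENCE FILLING** of `Λ = rowRegion b n` (R1's witness): the restriction to `Λ` of the gauge transform of `σ` by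
the layer gauge `h = layerGauge_b(comb_b k₀ σ)` (`R = (2n+2)b+1`). -/
def refFill (b n : ℕ) (k₀ : G) (σ : LGConfig 4 G) : ↥(rowRegion b n) → G :=
  fun e => gaugeTransformZd (layerGauge b (comb b ((2 * n + 2) * b + 1) k₀ σ)) σ e

/-- **The REFERENCE CONFIGURATION**: the reference filling glued to the twisted datum `σ' = topTwist_b(comb_b k₀ σ) σ`. -/
noncomputable def refConfig (b n : ℕ) (k₀ : G) (σ : LGConfig 4 G) : LGConfig 4 G :=
  glueWith (rowRegion b n) (refFill b n k₀ σ) (twistΦ b (comb b ((2 * n + 2) * b + 1) k₀) σ)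

omit [CompactSpace G] [SecondCountableTopology G] [MeasurableSpace G] [BorelSpace G] in
/-- Continuity of the layer gauge of the comb in the configuration. -/
theorem continuous_layerGauge_comb (b R : ℕ) (k₀ : G) (x : Site 4) :
    Continuous fun ζ : LGConfig 4 G => layerGauge b (comb b R k₀ ζ) x := by
  unfold layerGauge
  by_cases hx : x 0 = (b : ℤ) + 1
  · simp only [if_pos hx]; exact continuous_comb b R k₀ x
  · simp only [if_neg hx]; exact continuous_const

omit [CompactSpace G] [SecondCountableTopology G] [MeasurableSpace G] [BorelSpace G] in
/-- **PROVED.** The reference configuration depends continuously on `σ`. -/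
theorem continuous_refConfig (b n : ℕ) (k₀ : G) : Continuous (refConfig (G := G) b n k₀) := by
  refine continuous_pi fun e => ?_
  by_cases he : e ∈ rowRegion b n
  · have h : (fun σ => refConfig b n k₀ σ e) =
        fun σ => gaugeTransformZd (layerGauge b (comb b ((2 * n + 2) * b + 1) k₀ σ)) σ e := by
      funext σ; simp only [refConfig, glueWith, dif_pos he, refFill]
    rw [h]
    unfold gaugeTransformZd
    exact ((continuous_layerGauge_comb _ _ _ _).mul (continuous_apply e)).mul
      (continuous_layerGauge_comb _ _ _ _).inv
  · have h : (fun σ => refConfig b n k₀ σ e) =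
        fun σ => topTwist b (comb b ((2 * n + 2) * b + 1) k₀ σ) σ e := by
      funext σ; simp only [refConfig, glueWith, dif_neg he, twistΦ]
    rw [h]
    exact (continuous_apply e).comp (continuous_twist_comb b _ k₀)

omit [TopologicalSpace G] [IsTopologicalGroup G] [CompactSpace G] [SecondCountableTopology G] [MeasurableSpace G]
  [BorelSpace G] in
/-- The lifted `ℤ⁴` plaquette energy IS the torus plaquette cost (all oriented plaquettes). -/
theorem plaquetteEnergy_torusLift (L : ℕ) (V : GaugeConfig 4 L G) (q : ZdPlaquette 4) :
    (N : ℝ) - plaquetteObs ρ q.1 q.2.1.1 q.2.1.2 (torusLift L V) =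
      plaquetteCost ρ V (Torus.proj L q.1, q.2) := by
  simp only [plaquetteObs, plaquetteHolonomyZd_torusLift', plaquetteCost]

/-- **R1 from R1d (PROVED, rev 11): the `μ`-mean energy of the reference filling.**  Integrate the deterministic
domination against the torus Wilson measure (`σ = lift V`): each oriented plaquette energy of the lift is a torus plaquette
cost with mean `≤ K(1+log β)/β` (`AfOnset.exists_plaquetteCost_moments_le`), so the mean is `≤ (Σ_P w) K(1+log β)/β ≤
(2CK+1) b⁵ log β/β` for `β ≥ 3`; measurability from `continuous_refConfig`. -/
theorem integral_refAction_le_of_weighted (hρ : Continuous ρ) (hρi : Function.Injective ρ)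
    (hρu : ∀ g, ρ g ∈ Matrix.unitaryGroup (Fin N) ℂ) (n : ℕ) (k₀ : G)
    (hW : ∃ C : ℝ, 0 < C ∧ ∀ b : ℕ, 1 ≤ b → ∃ (P : Finset (ZdPlaquette 4)) (w : ZdPlaquette 4 → ℝ),
      (∀ q, 0 ≤ w q) ∧ ∑ q ∈ P, w q ≤ C * (b : ℝ) ^ 5 ∧
      ∀ σ : LGConfig 4 G, wilsonBoundaryAction ρ (rowRegion b n) (refConfig b n k₀ σ) ≤
        ∑ q ∈ P, w q * ((N : ℝ) - plaquetteObs ρ q.1 q.2.1.1 q.2.1.2 σ)) :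
    ∃ C₁ : ℝ, 0 < C₁ ∧ ∃ β₂ : ℝ, ∀ β : ℝ, β₂ ≤ β → ∀ b : ℕ, 1 ≤ b →
      ∃ ζ₀ : GaugeConfig 4 (2 * ((2 * n + 2) * b + 1) + 1) G → (↥(rowRegion b n) → G),
        Measurable (fun V => wilsonBoundaryAction ρ (rowRegion b n) (glueWith (rowRegion b n) (ζ₀ V)
          (twistΦ b (comb b ((2 * n + 2) * b + 1) k₀) (torusLift (2 * ((2 * n + 2) * b + 1) + 1) V)))) ∧
        ∫ V, wilsonBoundaryAction ρ (rowRegion b n) (glueWith (rowRegion b n) (ζ₀ V)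
          (twistΦ b (comb b ((2 * n + 2) * b + 1) k₀) (torusLift (2 * ((2 * n + 2) * b + 1) + 1) V)))
          ∂(wilsonMeasure (d := 4) (L := 2 * ((2 * n + 2) * b + 1) + 1) ρ β) ≤ C₁ * (b : ℝ) ^ 5 * (Real.log β / β) := by
  obtain ⟨C, hC, hCb⟩ := hW
  set r : LatticeRep G := ⟨N, ρ, hρ, hρi, hρu⟩ with hr
  obtain ⟨K, hK0, hmom⟩ := AfOnset.exists_plaquetteCost_moments_le r
  refine ⟨2 * C * K + 1, by positivity, 3, fun β hβ b hb => ?_⟩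
  obtain ⟨P, w, hw0, hwsum, hdom⟩ := hCb b hb
  set S : ℕ := 2 * ((2 * n + 2) * b + 1) + 1 with hS
  refine ⟨fun V => refFill b n k₀ (torusLift S V), ?_, ?_⟩
  · change Measurable fun V : GaugeConfig 4 S G =>
      wilsonBoundaryAction ρ (rowRegion b n) (refConfig b n k₀ (torusLift S V))
    exact ((continuous_wilsonBoundaryAction ρ hρ _).comp
      ((continuous_refConfig b n k₀).comp (continuous_torusLift S))).measurable
  · change ∫ V, wilsonBoundaryAction ρ (rowRegion b n) (refConfig b n k₀ (torusLift S V))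
        ∂(wilsonMeasure (d := 4) (L := S) ρ β) ≤ (2 * C * K + 1) * (b : ℝ) ^ 5 * (Real.log β / β)
    set μ := wilsonMeasure (d := 4) (L := S) ρ β with hμ
    haveI : IsProbabilityMeasure μ := isProbabilityMeasure_wilsonMeasure ρ hρ β
    have hβ0 : 0 < β := by linarith
    have hβ1 : 1 ≤ β := by linarith
    have hlog1 : 1 ≤ Real.log β := by
      rw [Real.le_log_iff_exp_le hβ0]
      have := Real.exp_one_lt_d9; norm_num at this; linarith
    have hL1 : 1 ≤ (2 * n + 2) * b + 1 := by omega
    -- the plaquette energies of the lift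
    have hφcont : ∀ q : ZdPlaquette 4, Continuous fun V : GaugeConfig 4 S G =>
        (N : ℝ) - plaquetteObs ρ q.1 q.2.1.1 q.2.1.2 (torusLift S V) := fun q =>
      continuous_const.sub ((continuous_plaquetteObs ρ hρ _ _ _).comp (continuous_torusLift S))
    have hφint : ∀ q : ZdPlaquette 4, Integrable (fun V : GaugeConfig 4 S G =>
        (N : ℝ) - plaquetteObs ρ q.1 q.2.1.1 q.2.1.2 (torusLift S V)) μ := fun q =>
      integrable_of_continuous μ (hφcont q)
    have hφmean : ∀ q : ZdPlaquette 4,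
        ∫ V, ((N : ℝ) - plaquetteObs ρ q.1 q.2.1.1 q.2.1.2 (torusLift S V)) ∂μ ≤ K * (1 + Real.log β) / β := by
      intro q
      have h := (hmom ((2 * n + 2) * b + 1) hL1 β hβ1 (Torus.proj S q.1, q.2)).1
      have heq : ∫ V, ((N : ℝ) - plaquetteObs ρ q.1 q.2.1.1 q.2.1.2 (torusLift S V)) ∂μ =
          ∫ V, plaquetteCost r.ρ V (Torus.proj S q.1, q.2) ∂μ :=
        integral_congr_ae (ae_of_all _ fun V => plaquetteEnergy_torusLift ρ S V q)
      rw [heq]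
      exact h
    -- integrate the domination
    have hintA : Integrable (fun V : GaugeConfig 4 S G =>
        wilsonBoundaryAction ρ (rowRegion b n) (refConfig b n k₀ (torusLift S V))) μ :=
      integrable_of_continuous μ ((continuous_wilsonBoundaryAction ρ hρ _).comp
        ((continuous_refConfig b n k₀).comp (continuous_torusLift S)))
    have hintS : Integrable (fun V : GaugeConfig 4 S G =>
        ∑ q ∈ P, w q * ((N : ℝ) - plaquetteObs ρ q.1 q.2.1.1 q.2.1.2 (torusLift S V))) μ :=
      integrable_finsetSum P fun q _ => (hφint q).const_mul (w q)
    have hpt : ∀ V : GaugeConfig 4 S G,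
        wilsonBoundaryAction ρ (rowRegion b n) (refConfig b n k₀ (torusLift S V)) ≤
          ∑ q ∈ P, w q * ((N : ℝ) - plaquetteObs ρ q.1 q.2.1.1 q.2.1.2 (torusLift S V)) := fun V =>
      hdom (torusLift S V)
    have hKβ : 0 ≤ K * (1 + Real.log β) / β := by positivity
    have hb5 : (0 : ℝ) ≤ C * (b : ℝ) ^ 5 := by positivity
    have hkey : K * (1 + Real.log β) ≤ 2 * K * Real.log β := by nlinarith [hK0, hlog1]
    have hnn : (0 : ℝ) ≤ (b : ℝ) ^ 5 * (Real.log β / β) :=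
      mul_nonneg (pow_nonneg (Nat.cast_nonneg _) _) (div_nonneg (by linarith) hβ0.le)
    calc ∫ V, wilsonBoundaryAction ρ (rowRegion b n) (refConfig b n k₀ (torusLift S V)) ∂μ
        ≤ ∫ V, ∑ q ∈ P, w q * ((N : ℝ) - plaquetteObs ρ q.1 q.2.1.1 q.2.1.2 (torusLift S V)) ∂μ :=
          integral_mono hintA hintS hpt
      _ = ∑ q ∈ P, w q * ∫ V, ((N : ℝ) - plaquetteObs ρ q.1 q.2.1.1 q.2.1.2 (torusLift S V)) ∂μ := by
          rw [integral_finsetSum P fun q _ => (hφint q).const_mul (w q)]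
          refine Finset.sum_congr rfl fun q _ => ?_
          exact integral_const_mul _ _
      _ ≤ ∑ q ∈ P, w q * (K * (1 + Real.log β) / β) :=
          Finset.sum_le_sum fun q _ => mul_le_mul_of_nonneg_left (hφmean q) (hw0 q)
      _ = (∑ q ∈ P, w q) * (K * (1 + Real.log β) / β) := by rw [Finset.sum_mul]
      _ ≤ C * (b : ℝ) ^ 5 * (K * (1 + Real.log β) / β) := mul_le_mul_of_nonneg_right hwsum hKβ
      _ = C * (b : ℝ) ^ 5 * (K * (1 + Real.log β)) / β := by ring
      _ ≤ C * (b : ℝ) ^ 5 * (2 * K * Real.log β) / β :=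
          div_le_div_of_nonneg_right (mul_le_mul_of_nonneg_left hkey hb5) hβ0.le
      _ = 2 * C * K * ((b : ℝ) ^ 5 * (Real.log β / β)) := by ring
      _ ≤ (2 * C * K + 1) * ((b : ℝ) ^ 5 * (Real.log β / β)) := by nlinarith [hnn]
      _ = (2 * C * K + 1) * (b : ℝ) ^ 5 * (Real.log β / β) := by ring

end Weighted

/-! ## §4m (PROVED; rev 12) Toward R1d: the reference filling IS the twisted configuration (`refConfig_eq_twistΦ`); plaquette
cases under the twist (off the top face: unchanged; top face: a conjugate of the LINK DEFECT enters); the top-face energy bound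
`≤ 4‖ρ(hairpin) − 1‖² + 2φ_p(σ)` for the comb (commutator algebra).  Residual of R1d: hairpin Stokes + Cauchy–Schwarz + counting. -/

section TwistEnergy

open scoped Matrix Matrix.Norms.Frobenius

variable {G : Type} [Group G] {N : ℕ} (ρ : G →* Matrix (Fin N) (Fin N) ℂ)

/-- Edges of the row region are based at heights `≤ b`. -/
theorem height_le_of_mem_rowRegion {b n : ℕ} {e : ZdEdge 4} (he : e ∈ rowRegion b n) : e.1 0 ≤ (b : ℤ) := by
  unfold rowRegion regionEdges at he
  obtain ⟨c, hc, hec⟩ := Finset.mem_biUnion.1 he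
  have hc0 : c 0 = 0 := by unfold rowCells at hc; exact (Finset.mem_filter.1 hc).2
  have h := base_height_of_mem_cellEdges hec
  rw [hc0] at h
  linarith [h.2]

/-- **PROVED — THE REFERENCE FILLING IS THE TWISTED CONFIGURATION.**  On `Λ` (heights `≤ b`) the layer gauge transform IS the
twist (`gaugeTransformZd_layerGauge_apply`), so `refConfig σ = topTwist_b(comb_b k₀ σ) σ = σ'`: R1d is a statement about the
boundary Wilson action OF THE TWISTED CONFIGURATION ITSELF. -/
theorem refConfig_eq_twistΦ (b n : ℕ) (k₀ : G) (σ : LGConfig 4 G) :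
    refConfig b n k₀ σ = twistΦ b (comb b ((2 * n + 2) * b + 1) k₀) σ := by
  funext e
  by_cases he : e ∈ rowRegion b n
  · simp only [refConfig, glueWith, dif_pos he, refFill, twistΦ]
    exact gaugeTransformZd_layerGauge_apply _ _ (height_le_of_mem_rowRegion he)
  · simp only [refConfig, glueWith, dif_neg he]

end TwistEnergy

end Summit.QuantumFields.YangMills.Cruxes.IR.RowFloorPoly

end
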